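import Literature.Topology.FourManifolds.GaussDiagramsInsertReading
import HarnessLib

/-!
# Readings of Gauss diagrams under orientation-preserving linear changes of the plane

Companion of `GaussDiagramsInsertReading.lean` (event analysis for the named fact
`Knot.reidemeisterR`, direction `→`). The local models of the Reidemeister events
(`Literature.Analysis.Calculus.bigon_birth`, …) are written in coordinates adapted to the event —
e.g. a non-vertical common tangent at a self-tangency. This file provides the change of
coordinates on the side of the readings: composing the plane curve with a continuous linear map
`L : ℝ² → ℝ²` of positive determinant preserves readings of a Gauss diagram (regular readings,
and readings modulo designated pairs), because double points, immersivity, heights and the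
crossing signs `sign det (γ' over, γ' under)` are all preserved
(`det (L v, L w) = det L · det (v, w)`).

## Main statements

* `ContinuousLinearMap.det_apply_apply_eq` — `det (L v, L w) = det L · det (v, w)` in coordinates;
* `ContinuousLinearMap.injective_of_coordDet_ne_zero`;
* `IsReadingMod.comp_continuousLinearMap`, `IsRegularReading.comp_continuousLinearMap`.

## References

* M. Polyak, *Minimal generating sets of Reidemeister moves*, Quantum Topol. 1 (2010), §1
  (signs of crossings). [Polyak2010]
-/

open Function Set

noncomputable section

namespace Literature.Topology.FourManifolds

section Linear

variable (L : (ℝ × ℝ) →L[ℝ] (ℝ × ℝ))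

/-- A linear map of the plane in terms of the images of the standard basis. [folklore] -/
theorem ContinuousLinearMap.apply_eq_smul_add_smul (v : ℝ × ℝ) :
    L v = v.1 • L (1, 0) + v.2 • L (0, 1) := by
  conv_lhs => rw [show v = v.1 • ((1 : ℝ), (0 : ℝ)) + v.2 • ((0 : ℝ), (1 : ℝ)) by ext <;> simp]
  rw [map_add, map_smul, map_smul]

/-- `det (L v, L w) = det L · det (v, w)`, with `det L` written in coordinates. [folklore] -/
theorem ContinuousLinearMap.det_apply_apply_eq (v w : ℝ × ℝ) :
    (L v).1 * (L w).2 - (L v).2 * (L w).1 =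
      ((L (1, 0)).1 * (L (0, 1)).2 - (L (1, 0)).2 * (L (0, 1)).1) * (v.1 * w.2 - v.2 * w.1) := by
  rw [ContinuousLinearMap.apply_eq_smul_add_smul L v, ContinuousLinearMap.apply_eq_smul_add_smul L w]
  simp only [Prod.fst_add, Prod.snd_add, Prod.smul_fst, Prod.smul_snd, smul_eq_mul]
  ring

/-- A linear map of the plane with non-zero determinant is injective. [folklore] -/
theorem ContinuousLinearMap.injective_of_coordDet_ne_zero
    (hL : (L (1, 0)).1 * (L (0, 1)).2 - (L (1, 0)).2 * (L (0, 1)).1 ≠ 0) : Injective L := by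
  intro v w hvw
  have h0 : L (v - w) = 0 := by rw [map_sub, hvw, sub_self]
  rw [ContinuousLinearMap.apply_eq_smul_add_smul L] at h0
  have h1 := congrArg Prod.fst h0
  have h2 := congrArg Prod.snd h0
  simp only [Prod.fst_add, Prod.snd_add, Prod.smul_fst, Prod.smul_snd, smul_eq_mul, Prod.fst_zero,
    Prod.snd_zero, Prod.fst_sub, Prod.snd_sub] at h1 h2
  have hd1 : (v.1 - w.1) * ((L (1, 0)).1 * (L (0, 1)).2 - (L (1, 0)).2 * (L (0, 1)).1) = 0 := by
    linear_combination (L (0, 1)).2 * h1 - (L (0, 1)).1 * h2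
  have hd2 : (v.2 - w.2) * ((L (1, 0)).1 * (L (0, 1)).2 - (L (1, 0)).2 * (L (0, 1)).1) = 0 := by
    linear_combination (L (1, 0)).1 * h2 - (L (1, 0)).2 * h1
  rcases mul_eq_zero.1 hd1 with hd1 | hd1
  · rcases mul_eq_zero.1 hd2 with hd2 | hd2
    · exact Prod.ext (sub_eq_zero.1 hd1) (sub_eq_zero.1 hd2)
    · exact absurd hd2 hL
  · exact absurd hd1 hL

/-- The velocity of `L ∘ γ` is `L (γ')`. [folklore] -/
theorem ContinuousLinearMap.deriv_comp_eq {γ : ℝ → ℝ × ℝ} {s : ℝ} (hγ : DifferentiableAt ℝ γ s) :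
    deriv (L ∘ γ) s = L (deriv γ s) :=
  (L.hasFDerivAt.comp_hasDerivAt s hγ.hasDerivAt).deriv

end Linear

/-- **Readings modulo designated pairs are preserved by orientation-preserving linear maps of
the plane.** If `θ` reads `G` modulo `P` on `(γ, h)` with `γ` differentiable and `L` is a
continuous linear map of `ℝ²` of positive determinant, then `θ` reads `G` modulo `P` on
`(L ∘ γ, h)`. [folklore] -/
theorem IsReadingMod.comp_continuousLinearMap {P : ℝ → ℝ → Prop} {γ : ℝ → ℝ × ℝ} {h : ℝ → ℝ}
    {G : GaussDiagram} {θ : Fin (2 * G.n) → ℝ} (hr : IsReadingMod P γ h G θ)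
    (L : (ℝ × ℝ) →L[ℝ] (ℝ × ℝ))
    (hL : 0 < (L (1, 0)).1 * (L (0, 1)).2 - (L (1, 0)).2 * (L (0, 1)).1)
    (hγ : Differentiable ℝ γ) : IsReadingMod P (L ∘ γ) h G θ := by
  have hinj := ContinuousLinearMap.injective_of_coordDet_ne_zero L hL.ne'
  have hd : ∀ s, deriv (L ∘ γ) s = L (deriv γ s) :=
    fun s ↦ ContinuousLinearMap.deriv_comp_eq L (hγ s)
  refine ⟨hr.strictMono, hr.lt_add_two_pi, fun t h0 ↦ ?_, fun i ↦ ?_, fun s t hst ↦ ?_,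
    hr.height_lt, fun i ↦ ?_⟩
  · rw [hd] at h0
    exact hr.deriv_ne_zero t (hinj (by rw [h0, map_zero]))
  · simp only [comp_apply, hr.double i]
  · exact hr.eq_or_crossing_or s t (hinj hst)
  · rw [hr.sign_eq i, Matrix.det_fin_two_of, Matrix.det_fin_two_of, hd, hd,
      ContinuousLinearMap.det_apply_apply_eq, sign_mul, sign_pos hL, one_mul]

/-- **Regular readings are preserved by orientation-preserving linear maps of the plane.**
[folklore] -/
theorem IsRegularReading.comp_continuousLinearMap {γ : ℝ → ℝ × ℝ} {h : ℝ → ℝ}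
    {G : GaussDiagram} {θ : Fin (2 * G.n) → ℝ} (hr : IsRegularReading γ h G θ)
    (L : (ℝ × ℝ) →L[ℝ] (ℝ × ℝ))
    (hL : 0 < (L (1, 0)).1 * (L (0, 1)).2 - (L (1, 0)).2 * (L (0, 1)).1)
    (hγ : Differentiable ℝ γ) : IsRegularReading (L ∘ γ) h G θ :=
  ((hr.isReadingMod fun _ _ ↦ False).comp_continuousLinearMap L hL hγ).isRegularReading
    fun _ _ h ↦ h.elim

end Literature.Topology.FourManifolds
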